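import Summits.HubbardSuperconductivity.HubbardSuperconductivity.Theses.LogColdTorus

/-!
# Route `LogColdTorus` — assembly item `Assembly` (stmt-HubbardSuperconductivity-8814)

`Assembly : LogColdDWaveOrder → LogColdToGround → AverageToEvery → HubbardSuperconductivity`
(Theses/LogColdTorus.lean rev 3) is pure logic over the summit Statement:

* `LogColdDWaveOrder` delivers a doping `δ ∈ (0, 1/2)`, a coupling window `0 < U₁ < U₂`, a
  log-cold scale `κ₀ > 0` and an order constant `c > 0` such that for every `κ ≥ κ₀`, eventually
  in even `L` and uniformly in `U ∈ (U₁, U₂)`, the `(N_L, S^z = 0)`-sector Gibbs state of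
  `hubbardTorus 2 L 1 U` at `β = κ log L` has d-wave pair order `≥ c·L⁴`;
* `LogColdToGround` (descent) turns exactly this body into a floor `c'·L⁴` (`c' > 0`, beyond
  some `L₁`) for the sector ground-state AVERAGE (`Matrix.groundStateFunctional` of the
  sector-compressed Hamiltonian), uniformly on the window;
* `AverageToEvery` (every-ground-state upgrade) turns that floor into d_{x²-y²} pair-field
  long-range order along even sides for EVERY normalised sector ground-state sequence at SOME
  `U ∈ (U₁, U₂)` — which, with `0 < U₁ < U`, is by `δ`-unfolding the body of
  `Literature.Hubbard.DWaveSuperconductivityHubbard`, the definiens of `HubbardSuperconductivity`.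

The proof is the planner's glue (the body of the route file's deciding theorem `closes`), term
for term; no analysis, no new definitions. Sources: D. J. Scalapino, Phys. Rep. 250 (1995) 329
(d-wave pairing order parameter); Arovas–Berg–Kivelson–Raghu, Ann. Rev. CMP 13 (2022) 239.
-/

-- the mandated namespace `Summit.<Summit>.<Problem>.Theorems` repeats `HubbardSuperconductivity`
-- (single-problem summit, D-0017), which the `dupNamespace` linter flags on every declaration
set_option linter.dupNamespace false

namespace Summit.HubbardSuperconductivity.HubbardSuperconductivity.Theorems

/-- **Assembly of route `LogColdTorus`** (item `stmt-HubbardSuperconductivity-8814`):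
`LogColdDWaveOrder → LogColdToGround → AverageToEvery → HubbardSuperconductivity`.
Pure logic: `LogColdDWaveOrder` gives `δ, U₁, U₂, κ₀, c` and the log-cold sector order;
`LogColdToGround` applied to these data gives the ground-state-average floor `c' > 0` beyond `L₁`;
`AverageToEvery` applied to that floor gives `U ∈ (U₁, U₂)` and d-wave pair-field LRO of every
normalised sector ground-state sequence at `(U, δ)`; since `0 < U₁ < U` this is the body of the
summit `HubbardSuperconductivity = DWaveSuperconductivityHubbard`. [folklore] -/
theorem logColdTorus_assembly_proof :
    Summit.HubbardSuperconductivity.HubbardSuperconductivity.Theses.LogColdTorus.Assembly := by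
  unfold Summit.HubbardSuperconductivity.HubbardSuperconductivity.Theses.LogColdTorus.Assembly
  intro h1 h2 h3
  obtain ⟨δ, hδ, U₁, U₂, hU₁, hU₁₂, κ₀, c, hκ₀, hc, h⟩ := h1
  obtain ⟨c', hc', L₁, hhub⟩ := h2 δ U₁ U₂ κ₀ c hU₁ hU₁₂ hκ₀ hc h
  obtain ⟨U, hU, hLRO⟩ := h3 δ U₁ U₂ c' L₁ hU₁ hU₁₂ hc' hhub
  show Literature.Hubbard.DWaveSuperconductivityHubbard
  exact ⟨U, lt_trans hU₁ hU.1, δ, hδ, hLRO⟩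

end Summit.HubbardSuperconductivity.HubbardSuperconductivity.Theorems
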